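import Summits.QuantumFields.BalabanUV.T4Continuum.E3Cert.ZL2d2AllU.S0
import Summits.QuantumFields.BalabanUV.T4Continuum.E3Cert.ZL2d2AllU.S1
import Summits.QuantumFields.BalabanUV.T4Continuum.E3Cert.ZL2d2AllU.S2
/-! E3 certificate `zL2d2AllU` (INTEGER CHUNKED TREE PACKAGE) emitted by bal_e3_lean_emit.py from `abs_L2d2_allU.json`.
lattice {'d': 2, 'L': 2, 'k': 1, 'M': 1, 'bc': 'block', 'a': '1', 'm2': '0', 'ncomp': 4, 'rep': 'fund', 'field': 'H=R^4, link acts by LEFT quaternion multiplication', 'contour': 'taxi from block corner, axis 0 first'}; global scale M = 1048576; gamma = M·γ = 1045504 (γ = 1021/1024); hypotheses none c0=None plaq_eps=None; deficit none.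
claim: for all real x with |x_t|^2 = 1 for every free link t:  H(x) - gamma I is PSD, H = eta^-2 K_U + a eta^-d A_U^T A_U on one L^k block with Neumann b.c. (B4 (1.3)-(1.6)); by Neumann decoupling the same gamma bounds -Delta_U + a P_1(U) from below on every union of blocks / torus for every U|block in the set
Layout: Data.lean (the certificate), S<i>.lean (≤ 8 kernel `decide` theorems each — one Lean process per file keeps kernel memory bounded), Main.lean (assembly + `zL2d2AllU_nonneg`).
HONEST RIDER (substrate cell E3 PILOT, typer ruling (μ3)(d), journal l.19196; module docstring only, data untouched): certified computation on ONE
(2,2,1) block, d = 2, SU(2) ≅ S³ links in the quaternion model: an explicit constant of the FIXED-BLOCK inequality shape [B4] §4 (4.7) (print itself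
reduces (1.8) to fixed-size block inequalities by Neumann separation, pp. 589–590) at these sizes — NOT by itself Prop. (1.8) (no Ω-assembly, d = 4
general-k tower not covered), NOT an input of any NE row today, NOT infinite volume ∕ mass gap ∕ Clay.  TREE COPY of the lane package
`run/shared/lean/ttrl/balaban-calc/e3/lean-draft/tree/zL2d2AllU/` (import prefix substituted, one-line docstrings added BY SCRIPT; no literal touched). -/
namespace E3Z

/-- E3 certificate `zL2d2AllU` component: `zL2d2AllU_main` (lane output, transcribed verbatim; see the module docstring). -/
theorem zL2d2AllU_main : ∀ k, k < zL2d2AllU.dim + 1 → GramCert.mainSlice zL2d2AllU k = true := by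
  rw [zL2d2AllU_len_dim]; exact (allBelow (fun k => GramCert.mainSlice zL2d2AllU k = true) 16 (allBelow (fun k => GramCert.mainSlice zL2d2AllU k = true) 15 (allBelow (fun k => GramCert.mainSlice zL2d2AllU k = true) 14 (allBelow (fun k => GramCert.mainSlice zL2d2AllU k = true) 13 (allBelow (fun k => GramCert.mainSlice zL2d2AllU k = true) 12 (allBelow (fun k => GramCert.mainSlice zL2d2AllU k = true) 11 (allBelow (fun k => GramCert.mainSlice zL2d2AllU k = true) 10 (allBelow (fun k => GramCert.mainSlice zL2d2AllU k = true) 9 (allBelow (fun k => GramCert.mainSlice zL2d2AllU k = true) 8 (allBelow (fun k => GramCert.mainSlice zL2d2AllU k = true) 7 (allBelow (fun k => GramCert.mainSlice zL2d2AllU k = true) 6 (allBelow (fun k => GramCert.mainSlice zL2d2AllU k = true) 5 (allBelow (fun k => GramCert.mainSlice zL2d2AllU k = true) 4 (allBelow (fun k => GramCert.mainSlice zL2d2AllU k = true) 3 (allBelow (fun k => GramCert.mainSlice zL2d2AllU k = true) 2 (allBelow (fun k => GramCert.mainSlice zL2d2AllU k = true) 1 (allBelow (fun k => GramCert.mainSlice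 zL2d2AllU k = true) 0 (allBelowZero (fun k => GramCert.mainSlice zL2d2AllU k = true)) zL2d2AllU_sl0) zL2d2AllU_sl1) zL2d2AllU_sl2) zL2d2AllU_sl3) zL2d2AllU_sl4) zL2d2AllU_sl5) zL2d2AllU_sl6) zL2d2AllU_sl7) zL2d2AllU_sl8) zL2d2AllU_sl9) zL2d2AllU_sl10) zL2d2AllU_sl11) zL2d2AllU_sl12) zL2d2AllU_sl13) zL2d2AllU_sl14) zL2d2AllU_sl15) zL2d2AllU_sl16)

/-- E3 certificate `zL2d2AllU` component: `zL2d2AllU_hb` (lane output, transcribed verbatim; see the module docstring). -/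
theorem zL2d2AllU_hb : ∀ i, i < zL2d2AllU.blocks.length → (GramCert.blockCert zL2d2AllU.nx zL2d2AllU.basis (zL2d2AllU.blocks.getD i (⟨[], 0, [], 0, []⟩, 0)).1).check = true := by
  rw [zL2d2AllU_len_blocks]; exact (allBelow (fun i => (GramCert.blockCert zL2d2AllU.nx zL2d2AllU.basis (zL2d2AllU.blocks.getD i (⟨[], 0, [], 0, []⟩, 0)).1).check = true) 1 (allBelow (fun i => (GramCert.blockCert zL2d2AllU.nx zL2d2AllU.basis (zL2d2AllU.blocks.getD i (⟨[], 0, [], 0, []⟩, 0)).1).check = true) 0 (allBelowZero (fun i => (GramCert.blockCert zL2d2AllU.nx zL2d2AllU.basis (zL2d2AllU.blocks.getD i (⟨[], 0, [], 0, []⟩, 0)).1).check = true)) zL2d2AllU_blk0) zL2d2AllU_blk1)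

/-- E3 certificate `zL2d2AllU` component: `zL2d2AllU_hs` (lane output, transcribed verbatim; see the module docstring). -/
theorem zL2d2AllU_hs : ∀ i, i < zL2d2AllU.ineq.length → (GramCert.blockCert zL2d2AllU.nx zL2d2AllU.basis (zL2d2AllU.ineq.getD i ([], ⟨[], 0, [], 0, []⟩, 0)).2.1).check = true := by
  rw [zL2d2AllU_len_ineq]; exact (allBelowZero (fun i => (GramCert.blockCert zL2d2AllU.nx zL2d2AllU.basis (zL2d2AllU.ineq.getD i ([], ⟨[], 0, [], 0, []⟩, 0)).2.1).check = true))

/-- E3 certificate `zL2d2AllU` component: `zL2d2AllU_he` (lane output, transcribed verbatim; see the module docstring). -/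
theorem zL2d2AllU_he : ∀ i, i < zL2d2AllU.eq.length → GramCert.eqCheck (zL2d2AllU.eq.getD i ([], [], [])) = true := by
  rw [zL2d2AllU_len_eq]; exact (allBelow (fun i => GramCert.eqCheck (zL2d2AllU.eq.getD i ([], [], [])) = true) 0 (allBelowZero (fun i => GramCert.eqCheck (zL2d2AllU.eq.getD i ([], [], [])) = true)) zL2d2AllU_eq0)

/-- KERNEL-CERTIFIED (integer chunked tree package): on the hypothesis set, 0 ≤ M·(vᵀH(x)v − γ|v|²) for every real (x, v). -/
theorem zL2d2AllU_nonneg (X : ℕ → ℝ) (hsph : ∀ ew ∈ zL2d2AllU.eq, Poly.eval X ew.1 = 0) (hin : ∀ gi ∈ zL2d2AllU.ineq, 0 ≤ Poly.eval X gi.1) :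
    0 ≤ Poly.eval X zL2d2AllU.quadH - (zL2d2AllU.gamma : ℝ) * Poly.eval X ((List.range zL2d2AllU.dim).map (fun i => ([(zL2d2AllU.nx + i, 2)], (1 : ℤ)))) :=
  GramCert.main_sound_sliced X zL2d2AllU zL2d2AllU_main zL2d2AllU_hb zL2d2AllU_hs zL2d2AllU_he hsph hin

end E3Z
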